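import Summits.QuantumFields.BalabanUV.T4Continuum.Support.NE7FlatLoopCommute
import HarnessLib

/-!
# NE7SymmetricFlatNearOfACU — (NEAR-FLAT_K) FROM ONE MATRIX-ANALYSIS LETTER: «almost flat ⇒ near a flat datum AT LEAST AS SYMMETRIC», by F29's compactness run in
# LOOP COORDINATES, GIVEN (ACU) «unitaries near a commuting unitary family have unitary approximants that commute with the commutant of the given ones and keep
# the trivial 4-letter words» (file S3c-2b of the `k`-uniform stabiliser lifting programme)

Cell `pub-balaban`, rung (B)+1 sub-cell t4, lineage `b2b-balaban-t4-ne7b-p1` (row NE7b OWNER + CRUX PROVER; junction service for row NE7, ruling R-OWNER-149-1 (2)),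
generation 159.  Memo `t4/b2b-balaban-t4-ne7b-p1/g159/records/S3-BRIEF.md` §2 (c).
THE ARGUMENT.  Suppose (NEAR-FLAT_K) fails for `ε′`: bad data `V_j`, `(1/(j+1))`-flat, unitary, `N`-periodic.  A cluster point `V⋆` in the compact class (F29: ✓ `isCompact_sfClass`)
is FLAT, so its loop family `c = ℓ(V⋆)` (axial transport; ✓ `NE7FlatLoopCommute`) is a COMMUTING family of unitaries with trivial plaquette words.  (ACU) at `c` gives `δ`;
the matrix loop map is continuous, so some `V_j` has loop family `a = ℓ(V_j)` within `min(δ, ε′/2)` of `c`; (ACU) returns unitaries `f` within `ε′/2` of `c`, commuting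
with the commutant of `a`, with trivial plaquette words.  The RECONSTRUCTION `F = A⁻¹ f A` along `V_j`'s axial transport (✓ `NE7CombLoopReconstruction`) is unitary,
`N`-periodic, FLAT, bondwise within `ε′` of `V_j`, and FIXED by every stabiliser element `s` of `V_j` (`s = A⁻¹ s(0) A` with `s(0)` in the commutant of `a`, hence of `f`)
— contradicting badness.
WHAT ([folklore]; 0 def, 0 sorry; generic `d`, every `U(n)`).  **`exists_symmetric_flat_near_of_ACU`**: (ACU)(n, N, d) ⟹ `∀ ε′ > 0 ∃ γ > 0 ∀ V` (unitary, `N`-periodic,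
`SmallField V γ`) `∃ F` unitary `N`-periodic FLAT with `‖F(b)⁻¹V(b) − 1‖ ≤ ε′` on every bond and `F^s = F` for every unitary `N`-periodic `s` with `V^s = V` — the letter
(NEAR-FLAT_K) of ✓ `NE7StabiliserLiftingUniformOfNearFlat`, now conditional only on (ACU), a statement about `n × n` matrices (S3b; ✓ `NE7AlmostProjection` is its first brick).
HONEST FRAMING (page 1): soft topology + lattice kinematics; (ACU) is a HYPOTHESIS asserted for nothing; nothing of Bałaban's; NOT NE7, NOT NE3; row NE7b NOT PRINTED ∕ NOT PROVED;
spine 0∕9; finite T⁴ rung (B)+1 — NOT infinite volume, NOT mass gap, NOT BetaPertH, NOT Clay.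
-/

set_option autoImplicit false

open scoped BigOperators Matrix Matrix.Norms.L2Operator Topology
open Filter Set

namespace Summit.QuantumFields.BalabanUV.T4Continuum.NE7SymmetricFlatNearOfACU

open Literature.MathematicalPhysics.QuantumFieldTheory.Balaban1983to89
open B7Prop1Explicit B7Prop2Explicit
open T4AveragingDeficitWall (IsUnitaryCfg SmallField)
open T4AveragingDeficitWallBoundary (IsPeriodicCfg periodBox)
open AveragingDeficitTorusChart (redN redN_boxVec)
open AveragingDeficitFermat (boxVec_redN_mem)
open NE3EnergyShapes (IsUnitarySite IsPeriodicSite)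
open MinimalActionRate (sfClass)
open MinimalActionCompact (isCompact_sfClass isClosed_smallField)
open NE7SoftDataPath (relNorm_eq_box)
open NE7CombLoopReconstruction (isPeriodicCfg_recon isUnitaryCfg_recon smallField_zero_recon gaugeAct_recon_of_conj norm_recon_inv_mul_sub_one
  stab_eq_conj_axial commute_loop_of_stab)
open NE7FlatLoopCommute (commute_loop_of_flat loop_plaqWord_eq_one_of_flat val_loop_eq continuous_loopMatrix)

noncomputable section

variable {d : ℕ} {n : Type} [Fintype n] [DecidableEq n]

/-- **(NEAR-FLAT_K) FROM (ACU)** (statement in the module docstring). [folklore] -/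
theorem exists_symmetric_flat_near_of_ACU [Nonempty n] {N : ℕ} [NeZero N]
    (hACU : ∀ (c : (Fin d → Fin N) → Fin d → Matrix n n ℂ), (∀ r κ, c r κ ∈ unitary (Matrix n n ℂ)) →
      (∀ r κ r' κ', c r κ * c r' κ' = c r' κ' * c r κ) →
      ∀ ε : ℝ, 0 < ε → ∃ δ : ℝ, 0 < δ ∧ ∀ (a : (Fin d → Fin N) → Fin d → Matrix n n ℂ), (∀ r κ, a r κ ∈ unitary (Matrix n n ℂ)) →
        (∀ r κ, ‖a r κ - c r κ‖ ≤ δ) →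
        ∃ f : (Fin d → Fin N) → Fin d → Matrix n n ℂ, (∀ r κ, f r κ ∈ unitary (Matrix n n ℂ)) ∧ (∀ r κ, ‖f r κ - c r κ‖ ≤ ε) ∧
          (∀ z : Matrix n n ℂ, (∀ r κ, z * a r κ = a r κ * z) → ∀ r κ, z * f r κ = f r κ * z) ∧
          (∀ r₁ κ₁ r₂ κ₂ r₃ κ₃ r₄ κ₄, c r₁ κ₁ * c r₂ κ₂ * star (c r₃ κ₃) * star (c r₄ κ₄) = 1 →
            f r₁ κ₁ * f r₂ κ₂ * star (f r₃ κ₃) * star (f r₄ κ₄) = 1))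
    {ε' : ℝ} (hε' : 0 < ε') :
    ∃ γ : ℝ, 0 < γ ∧ ∀ V : Site d → Fin d → (Matrix n n ℂ)ˣ, IsUnitaryCfg V → IsPeriodicCfg V (N : ℤ) → SmallField V γ →
      ∃ F : Site d → Fin d → (Matrix n n ℂ)ˣ, IsUnitaryCfg F ∧ IsPeriodicCfg F (N : ℤ) ∧ SmallField F 0 ∧
        (∀ (x : Site d) (κ : Fin d), ‖(((F x κ)⁻¹ : (Matrix n n ℂ)ˣ) : Matrix n n ℂ) * (V x κ : Matrix n n ℂ) - 1‖ ≤ ε') ∧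
        ∀ s : Site d → (Matrix n n ℂ)ˣ, IsUnitarySite s → IsPeriodicSite s (N : ℤ) → gaugeAct s V = V → gaugeAct s F = F := by
  classical
  by_contra hcon
  push Not at hcon
  -- a bad sequence
  have hseq : ∀ j : ℕ, ∃ V : Site d → Fin d → (Matrix n n ℂ)ˣ, IsUnitaryCfg V ∧ IsPeriodicCfg V (N : ℤ) ∧ SmallField V (1 / ((j : ℝ) + 1)) ∧
      ∀ F : Site d → Fin d → (Matrix n n ℂ)ˣ, IsUnitaryCfg F → IsPeriodicCfg F (N : ℤ) → SmallField F 0 →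
        (∀ (x : Site d) (κ : Fin d), ‖(((F x κ)⁻¹ : (Matrix n n ℂ)ˣ) : Matrix n n ℂ) * (V x κ : Matrix n n ℂ) - 1‖ ≤ ε') →
        ∃ s : Site d → (Matrix n n ℂ)ˣ, IsUnitarySite s ∧ IsPeriodicSite s (N : ℤ) ∧ gaugeAct s V = V ∧ gaugeAct s F ≠ F := by
    intro j
    obtain ⟨V, hVu, hVP, hVs, hbad⟩ := hcon (1 / ((j : ℝ) + 1)) (by positivity)
    exact ⟨V, hVu, hVP, hVs, fun F hFu hFP hF0 hclose => hbad F hFu hFP hF0 hclose⟩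
  choose V hVu hVP hVs hVbad using hseq
  -- the compact class containing the sequence, a cluster point, which is flat
  set K : Set (Site d → Fin d → (Matrix n n ℂ)ˣ) := sfClass d 1 N 1 0 with hKdef
  have hK : IsCompact K := isCompact_sfClass (d := d) (n := n) 1 N 1 0
  have hVK : ∀ j, V j ∈ K := by
    intro j
    refine ⟨hVu j, ?_, ?_⟩
    · simpa using hVP j
    · have h1 : 1 / ((j : ℝ) + 1) ≤ 1 / (((1 : ℕ) : ℝ) ^ 0) ^ 2 := by
        rw [pow_zero, one_pow, div_one]
        exact (div_le_one (by positivity)).mpr (by linarith [(Nat.cast_nonneg j : (0 : ℝ) ≤ j)])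
      exact MinimalActionRate.SmallField.mono (hVs j) h1
  set fl : Filter (Site d → Fin d → (Matrix n n ℂ)ˣ) := Filter.map V Filter.atTop with hfldef
  have hfK : fl ≤ 𝓟 K := Filter.le_principal_iff.mpr (Filter.eventually_map.mpr (Filter.Eventually.of_forall hVK))
  haveI : fl.NeBot := Filter.map_neBot
  obtain ⟨Vs, hVsK, hclu⟩ := hK hfK
  obtain ⟨hVsu, hVsP', -⟩ := hVsK
  have hVsP : IsPeriodicCfg Vs (N : ℤ) := by simpa using hVsP'
  have hVsmall : ∀ j₀ : ℕ, SmallField Vs (1 / ((j₀ : ℝ) + 1)) := by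
    intro j₀
    have hle : fl ≤ 𝓟 {U : Site d → Fin d → (Matrix n n ℂ)ˣ | SmallField U (1 / ((j₀ : ℝ) + 1))} := by
      refine Filter.le_principal_iff.mpr (Filter.eventually_map.mpr (Filter.eventually_atTop.mpr ⟨j₀, fun j hj => ?_⟩))
      refine MinimalActionRate.SmallField.mono (hVs j) ?_
      have hj' : (j₀ : ℝ) + 1 ≤ (j : ℝ) + 1 := by exact_mod_cast Nat.succ_le_succ hj
      exact one_div_le_one_div_of_le (by positivity) hj'
    have hmem : Vs ∈ closure {U : Site d → Fin d → (Matrix n n ℂ)ˣ | SmallField U (1 / ((j₀ : ℝ) + 1))} :=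
      mem_closure_iff_clusterPt.mpr (hclu.mono hle)
    rw [(isClosed_smallField (d := d) (n := n) (1 / ((j₀ : ℝ) + 1))).closure_eq] at hmem
    exact hmem
  have hflat : SmallField Vs 0 := by
    intro x κ μ hκ
    by_contra hpos
    push Not at hpos
    obtain ⟨j₀, hj₀⟩ := exists_nat_one_div_lt hpos
    have h := hVsmall j₀ x κ μ hκ
    linarith
  -- the matrix loop map and the limit loop family `c`
  set L : (Site d → Fin d → (Matrix n n ℂ)ˣ) → (Fin d → Fin N) → Fin d → Matrix n n ℂ := fun U r κ =>
    ((hol U 0 (treeWord (boxVec N r)) : (Matrix n n ℂ)ˣ) : Matrix n n ℂ) * (U (boxVec N r) κ : Matrix n n ℂ)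
      * star ((hol U 0 (treeWord (boxVec N (redN N (boxVec N r + e κ)))) : (Matrix n n ℂ)ˣ) : Matrix n n ℂ) with hL
  have hLval : ∀ {U : Site d → Fin d → (Matrix n n ℂ)ˣ}, IsUnitaryCfg U → ∀ r κ,
      L U r κ = ((hol U 0 (treeWord (boxVec N r)) * U (boxVec N r) κ * (hol U 0 (treeWord (boxVec N (redN N (boxVec N r + e κ)))))⁻¹ : (Matrix n n ℂ)ˣ) :
        Matrix n n ℂ) := fun hU r κ => (val_loop_eq N hU r κ).symm
  have hLunit : ∀ {U : Site d → Fin d → (Matrix n n ℂ)ˣ}, IsUnitaryCfg U → ∀ r κ, L U r κ ∈ unitary (Matrix n n ℂ) := by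
    intro U hU r κ
    rw [hLval hU]
    exact mem_unitaryUnits.mp ((unitaryUnits _).mul_mem ((unitaryUnits _).mul_mem (hol_mem_of hU _ _) (hU _ _))
      ((unitaryUnits _).inv_mem (hol_mem_of hU _ _)))
  set c := L Vs with hc
  have hcu : ∀ r κ, c r κ ∈ unitary (Matrix n n ℂ) := fun r κ => hLunit hVsu r κ
  have hccomm : ∀ r κ r' κ', c r κ * c r' κ' = c r' κ' * c r κ := by
    intro r κ r' κ'
    simp only [hc, hLval hVsu]
    have h := congrArg (fun u : (Matrix n n ℂ)ˣ => (u : Matrix n n ℂ)) (commute_loop_of_flat N hVsu hVsP hflat r r' κ κ')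
    simpa only [Units.val_mul] using h
  -- (ACU) at `c`
  obtain ⟨δ, hδ, hACUc⟩ := hACU c hcu hccomm (ε' / 2) (by positivity)
  -- the neighbourhood «loop family within min(δ, ε′/2) of c»
  set O : Set (Site d → Fin d → (Matrix n n ℂ)ˣ) := {U | ∀ (r : Fin d → Fin N) (κ : Fin d), ‖L U r κ - c r κ‖ < min δ (ε' / 2)} with hOdef
  have hOopen : IsOpen O := by
    have e1 : O = ⋂ r : Fin d → Fin N, ⋂ κ : Fin d, {U : Site d → Fin d → (Matrix n n ℂ)ˣ | ‖L U r κ - c r κ‖ < min δ (ε' / 2)} := by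
      ext U; simp only [hOdef, mem_setOf_eq, mem_iInter]
    rw [e1]
    refine isOpen_iInter_of_finite fun r => isOpen_iInter_of_finite fun κ => ?_
    exact isOpen_lt (((continuous_loopMatrix (d := d) (n := n) N r κ)).sub continuous_const).norm continuous_const
  have hVsO : Vs ∈ O := by
    intro r κ
    rw [hc, sub_self, norm_zero]
    exact lt_min hδ (by positivity)
  obtain ⟨U, hUO, ⟨j, rfl⟩⟩ := (clusterPt_iff_nonempty.mp hclu) (hOopen.mem_nhds hVsO) (Filter.range_mem_map)
  -- the approximants
  set a := L (V j) with ha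
  have hau : ∀ r κ, a r κ ∈ unitary (Matrix n n ℂ) := fun r κ => hLunit (hVu j) r κ
  have haδ : ∀ r κ, ‖a r κ - c r κ‖ ≤ δ := fun r κ => ((hUO r κ).trans_le (min_le_left _ _)).le
  obtain ⟨f, hfu, hfc, hfcomm, hfw⟩ := hACUc a hau haδ
  -- the units
  set fU : (Fin d → Fin N) → Fin d → (Matrix n n ℂ)ˣ := fun r κ =>
    ⟨f r κ, star (f r κ), Unitary.mul_star_self_of_mem (hfu r κ), Unitary.star_mul_self_of_mem (hfu r κ)⟩ with hfU
  have hfUu : ∀ r κ, fU r κ ∈ unitaryUnits (Matrix n n ℂ) := fun r κ => mem_unitaryUnits.mpr (hfu r κ)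
  set A : (Fin d → Fin N) → (Matrix n n ℂ)ˣ := fun r => hol (V j) 0 (treeWord (boxVec N r)) with hA
  have hAu : ∀ r, A r ∈ unitaryUnits (Matrix n n ℂ) := fun r => hol_mem_of (hVu j) _ _
  -- THE FLAT SYMMETRIC DATUM: the reconstruction of `f` along `V_j`'s axial transport
  set F : Site d → Fin d → (Matrix n n ℂ)ˣ := fun x κ => (A (redN N x))⁻¹ * fU (redN N x) κ * A (redN N (x + e κ)) with hF
  have hFu : IsUnitaryCfg F := isUnitaryCfg_recon N hAu hfUu
  have hFP : IsPeriodicCfg F (N : ℤ) := isPeriodicCfg_recon N A fU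
  -- loop units of `V⋆` and of `V_j`; their values are `c` and `a`
  have hcval : ∀ r κ, c r κ = ((hol Vs 0 (treeWord (boxVec N r)) * Vs (boxVec N r) κ
      * (hol Vs 0 (treeWord (boxVec N (redN N (boxVec N r + e κ)))))⁻¹ : (Matrix n n ℂ)ˣ) : Matrix n n ℂ) := fun r κ => hLval hVsu r κ
  have hcstar : ∀ r κ, star (c r κ) = (((hol Vs 0 (treeWord (boxVec N r)) * Vs (boxVec N r) κ
      * (hol Vs 0 (treeWord (boxVec N (redN N (boxVec N r + e κ)))))⁻¹)⁻¹ : (Matrix n n ℂ)ˣ) : Matrix n n ℂ) := by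
    intro r κ
    rw [hcval]
    exact (Units.inv_eq_of_mul_eq_one_right (Unitary.mul_star_self_of_mem (by rw [← hcval]; exact hcu r κ))).symm
  have haval : ∀ r κ, a r κ = ((hol (V j) 0 (treeWord (boxVec N r)) * V j (boxVec N r) κ
      * (hol (V j) 0 (treeWord (boxVec N (redN N (boxVec N r + e κ)))))⁻¹ : (Matrix n n ℂ)ˣ) : Matrix n n ℂ) := fun r κ => hLval (hVu j) r κ
  -- flatness: the plaquette words of `f` are those of `c`, which are `1`
  have hF0 : SmallField F 0 := by
    refine smallField_zero_recon N A fU fun x κ μ hκμ => ?_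
    have hw := loop_plaqWord_eq_one_of_flat N (fun r => hol Vs 0 (treeWord (boxVec N r))) hVsP hflat x hκμ
    beta_reduce at hw
    have hcw : c (redN N x) κ * c (redN N (x + e κ)) μ * star (c (redN N (x + e μ)) κ) * star (c (redN N x) μ) = 1 := by
      rw [hcval, hcval, hcstar, hcstar, ← Units.val_mul, ← Units.val_mul, ← Units.val_mul, hw, Units.val_one]
    have hfw1 := hfw _ _ _ _ _ _ _ _ hcw
    exact Units.ext (by simpa [hfU, Units.val_mul] using hfw1)
  -- closeness
  have hclose : ∀ (x : Site d) (κ : Fin d), ‖(((F x κ)⁻¹ : (Matrix n n ℂ)ˣ) : Matrix n n ℂ) * (V j x κ : Matrix n n ℂ) - 1‖ ≤ ε' := by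
    intro x κ
    have h1 := norm_recon_inv_mul_sub_one N hAu hfUu (hVP j) x κ
    have h2 : ‖(((F x κ)⁻¹ : (Matrix n n ℂ)ˣ) : Matrix n n ℂ) * (V j x κ : Matrix n n ℂ) - 1‖
        = ‖a (redN N x) κ - f (redN N x) κ‖ := by
      rw [haval]
      simpa only [hF, hA, hfU, Units.val_mul] using h1
    rw [h2]
    have h3 : ‖a (redN N x) κ - f (redN N x) κ‖ ≤ ‖a (redN N x) κ - c (redN N x) κ‖ + ‖f (redN N x) κ - c (redN N x) κ‖ := by
      rw [show a (redN N x) κ - f (redN N x) κ = (a (redN N x) κ - c (redN N x) κ) - (f (redN N x) κ - c (redN N x) κ) by abel]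
      exact norm_sub_le _ _
    have h4 : ‖a (redN N x) κ - c (redN N x) κ‖ < ε' / 2 := (hUO (redN N x) κ).trans_le (min_le_right _ _)
    linarith [hfc (redN N x) κ]
  -- symmetry: every stabiliser element of `V_j` fixes `F`
  have hsym : ∀ s : Site d → (Matrix n n ℂ)ˣ, IsUnitarySite s → IsPeriodicSite s (N : ℤ) → gaugeAct s (V j) = V j → gaugeAct s F = F := by
    intro s _ hsP hfix
    have hs : ∀ x : Site d, s x = (A (redN N x))⁻¹ * s 0 * A (redN N x) := fun x => stab_eq_conj_axial N hsP hfix x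
    have hz : ∀ r κ, (s 0 : Matrix n n ℂ) * a r κ = a r κ * (s 0 : Matrix n n ℂ) := by
      intro r κ
      have h := congrArg (fun u : (Matrix n n ℂ)ˣ => (u : Matrix n n ℂ)) (commute_loop_of_stab N hsP hfix r κ)
      simpa only [haval, Units.val_mul] using h
    have hcomm : ∀ r κ, s 0 * fU r κ = fU r κ * s 0 := by
      intro r κ
      exact Units.ext (by simpa [hfU, Units.val_mul] using hfcomm (s 0 : Matrix n n ℂ) hz r κ)
    exact gaugeAct_recon_of_conj N A fU hs hcomm
  -- contradiction with badness
  obtain ⟨s, hsu, hsP, hfix, hne⟩ := hVbad j F hFu hFP hF0 hclose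
  exact hne (hsym s hsu hsP hfix)

end

end Summit.QuantumFields.BalabanUV.T4Continuum.NE7SymmetricFlatNearOfACU
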